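import Summits.HodgeConjecture.HodgeConjecture.Theorems.Ring2AbelianAllAndreWeightTheta
import Summits.HodgeConjecture.HodgeConjecture.Theorems.Ring2AbelianAllAndreIsogenousPencilsFinite
import Literature.AlgebraicGeometry.Motives.AbelianVarietyLie
import HarnessLib

/-!
# Ring 2 · sub-cell AbelianAll (ALL ABELIAN VARIETIES), André axis, part XXXV-e — THE WEIGHT BRACKET (θ∀) WITHOUT ITS
# LOCAL QUASI-FINITENESS CLAUSE: an `S`-endomorphism `ν` of a compact pencil of abelian varieties charted by `[N]`, `N ≠ 0`,
# on every fibre is SURJECTIVE (fibrewise surjective onto the closed points, closed image, Jacobson total space), hence FINITE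
# (part XXXV-a), hence locally quasi-finite — so the displayed hypothesis (θ∀) `PencilTheta[]` of parts XXIV–XXVIII is implied
# by its chart clauses alone (`PencilTheta₀[] ⟹ PencilTheta[]`). FACT-FREE

HONEST FRAMING (page 1, verbatim): **research route, not a corollary; conditional on HC_CM plus one named
minimal statement.** Cell line: research route conditional on HC_CM; not a corollary; Q11.4-sentence-2 already
refuted in dim ≥ 3. Nothing in this file proves a case of the Hodge conjecture for an abelian variety; `HC_CM`
(`RankFourFaces.CMAbelianHodge`) is a HYPOTHESIS of the `HC_AV` rows, load-bearing as typed; item `Theses.RankFourFaces.CMToAbelian`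
(stmt-16267) OPEN and not closed here; no node is born (0 `def`), no named fact, no `sorry`; axioms standard; nothing minimal.

## What this part does

Parts XXIV–XXVIII display ONE weight hypothesis for the André-axis rows, the bracket (θ∀) `PencilTheta[]` (part XXVI-b): every
CM-pointed compact pencil of abelian varieties carries an `S`-endomorphism `ν` (`ν ≫ f = f`) WITH `LocallyQuasiFinite ν.left`, an
integer `N ≥ 2`, and on every fibre a chart `A.X ≅ X_s` in which `ν_s` is `N · 𝟙_A` (print: the multiplication `θ_N` of the abelian
scheme, Mumford GIT Thm. 6.14). The local quasi-finiteness clause was carried because pull-backs of algebraic classes along `ν` are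
needed (part XXIV-b `exists_topWeight_lift`). Here it is DERIVED from the chart clauses:

* §1 `surjective_left_of_fibre_charts` — an `S`-endomorphism of a compact abelian pencil charted on every fibre by `[N]`, `N ≠ 0`,
  is SURJECTIVE: `[N]` is an isogeny (`isIsogeny_zsmul_id_of_cast_ne_zero`, characteristic `0`), so every fibre map `ν_s` is onto;
  every closed point of `𝒳` lies on a fibre `X_s` (`range_fiberι_base_eq_preimage`, Nullstellensatz), so the image of `ν` contains
  all closed points; it is closed (`ν` is proper) and `𝒳` is Jacobson (`closure_closedPoints`), so it is everything.
  `isFinite_left_of_fibre_charts`, `locallyQuasiFinite_left_of_fibre_charts`: hence `ν` is finite (part XXXV-a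
  `isFinite_left_of_comp_eq`) and locally quasi-finite.
* §2 brackets (display-only, F-ab-103): `PencilTheta₀[]` := `PencilTheta[]` with the clause `LocallyQuasiFinite ν.left` DELETED;
  **`pencilTheta_of_pencilTheta₀ : PencilTheta₀[] → PencilTheta[]`**; the rows of part XXVI-b re-keyed on `PencilTheta₀[]`:
  `cmWeights_of_pencilTheta₀`, `HC_AV_of_HC_CM_of_cmTopWeightHodge_of_theta₀`, `HC_AV_iff_HC_CM_and_cmTopWeightHodge_of_verdier_of_theta₀`.

AFTER THIS PART the displayed weight hypothesis of the André-axis rows is EXACTLY the abelian-scheme structure in its weakest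
chart form: an `S`-endomorphism agreeing on every fibre, through some abelian-variety chart, with multiplication by one integer
`N ≥ 2` — nothing about finiteness, flatness or quasi-finiteness of `ν`. Still NOT in the tree (no group law over `S` on the
carriers); still display-only; nothing minimal; no node; `HC_AV` rows keep `HC_CM`, [h₂₁] (and Verdier for exactness) as before.

References: MumfordGIT (Thm. 6.14); MumfordAV1970 (§4 Cor. 1, §19 Thm. 1); GortzWedhorn2023 (Prop. 27.186–27.187: `[n]` finite
étale surjective); GortzWedhorn2020 (Cor. 12.89); DeJong1996 (proof of 4.13); StacksProject (Tags 02UP, 005X Jacobson); SGA1 (XII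
Prop. 2.4); Milne2020HodgeClassesAV (proof of Prop. 1); Andre1996Motifs (Lemme 6.3.1, Remarque 2); Verdier1976 (Cor. 5.1).
-/

noncomputable section

set_option linter.dupNamespace false

namespace Summit.HodgeConjecture.HodgeConjecture.Ring2.AbelianAll

open CategoryTheory CategoryTheory.Limits AlgebraicGeometry
open Literature.AlgebraicGeometry Literature.AlgebraicGeometry.Motives
open Literature.AlgebraicGeometry.HodgeTheory
open Literature.AlgebraicGeometry.Deligne1982 (cmLocus)
open Literature.AlgebraicGeometry.Andre1996 (andre1996_cmAnchoredPencil)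
open Literature.AlgebraicTopology.SingularHomology (singularCohomology)
open Summit.HodgeConjecture.HodgeConjecture
open Summit.HodgeConjecture.HodgeConjecture.Theses

variable {𝒳 S : SchemeOver ℂ} {d : ℕ} {f : 𝒳 ⟶ S}

/-! ## §1 An `S`-endomorphism charted by `[N]` on every fibre is surjective, hence finite -/

section Surjective

/-- **An `S`-endomorphism of a compact pencil of abelian varieties charted by `[N]`, `N ≠ 0`, on every fibre is SURJECTIVE.**
On each fibre `ν_s = e⁻¹ ≫ [N] ≫ e` is onto (`[N]` is an isogeny in characteristic `0`); every closed point of `𝒳` is a complex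
point on some fibre, so the image of `ν` contains the closed points; the image is closed (`ν` is proper: `𝒳` proper and separated
over `ℂ`) and the closed points of the Jacobson scheme `𝒳` are dense. [cite: GortzWedhorn2023, Prop. 27.186–27.187]
[cite: StacksProject, Tag 02UP] [cite: SGA1, Exp. XII Prop. 2.4] -/
theorem surjective_left_of_fibre_charts (hf : IsCompactAbelianPencil f d) (ν : 𝒳 ⟶ 𝒳) {N : ℕ} (hN : N ≠ 0)
    (hθ : ∀ s : ComplexPoints S, ∃ (νs : fiberOver f s ⟶ fiberOver f s) (A : AbelianVariety ℂ) (e : A.X ≅ fiberOver f s),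
      νs ≫ fiberι f s = fiberι f s ≫ ν ∧ e.hom ≫ νs = (N • 𝟙 A).hom.hom.hom ≫ e.hom) :
    Surjective ν.left := by
  haveI : IsProper 𝒳.hom := IsSmoothProjective.isProper_holds hf.isSmoothProjective_total
  haveI : IsProper ν.left := by
    have hc : IsProper (ν.left ≫ 𝒳.hom) := by rw [Over.w ν]; infer_instance
    exact IsProper.of_comp ν.left 𝒳.hom
  haveI : JacobsonSpace 𝒳.left := ComplexPoints.jacobsonSpace_left
  -- the closed points lie in the image
  have hclosed : closedPoints 𝒳.left ⊆ Set.range ν.left.base := by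
    intro y hy
    set x : ComplexPoints 𝒳 := (ComplexPoints.equivClosedPoints 𝒳).symm ⟨y, hy⟩ with hx
    have hxy : x.pt = y := by rw [hx, ComplexPoints.pt_equivClosedPoints_symm_apply]
    set s : ComplexPoints S := AlgPoints.map f x with hs
    have hyt : y ∈ Set.range (fiberι f s).left.base := by
      rw [range_fiberι_base_eq_preimage f s, Set.mem_preimage, Set.mem_singleton_iff, hs, AlgPoints.pt_map, hxy]
    obtain ⟨q, hq⟩ := hyt
    obtain ⟨νs, A, e, hνs, he⟩ := hθ s
    -- the fibre map is onto: `νs = e⁻¹ ≫ [N] ≫ e` with `[N]` an isogeny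
    haveI : Surjective νs.left := by
      have hνs' : νs = e.inv ≫ ((N • 𝟙 A).hom.hom.hom ≫ e.hom) := (Iso.eq_inv_comp e).2 he
      have hiso := AbelianVariety.isIsogeny_zsmul_id_of_cast_ne_zero (A := A) (N : ℤ) (by exact_mod_cast hN)
      rw [natCast_zsmul] at hiso
      haveI : Surjective (N • 𝟙 A).hom.hom.hom.left := hiso.1
      haveI : IsIso e.hom.left := ((Over.forget _).mapIso e).isIso_hom
      haveI : IsIso e.inv.left := ((Over.forget _).mapIso e.symm).isIso_hom
      rw [hνs', Over.comp_left, Over.comp_left]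
      infer_instance
    obtain ⟨q', hq'⟩ := ‹Surjective νs.left›.surj q
    refine ⟨(fiberι f s).left.base q', ?_⟩
    have h := congrArg (fun φ ↦ φ.left.base q') hνs
    simp only [Over.comp_left, Scheme.Hom.comp_base, TopCat.coe_comp, Function.comp_apply] at h
    rw [← h, hq', hq]
  -- the image is closed and the closed points are dense
  have hrange : IsClosed (Set.range ν.left.base) := ν.left.isClosedMap.isClosed_range
  refine ⟨fun y ↦ ?_⟩
  have hy : y ∈ closure (closedPoints 𝒳.left) := by rw [closure_closedPoints]; trivial
  exact hrange.closure_subset_iff.2 hclosed hy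

/-- Hence such an endomorphism is FINITE (part XXXV-a `isFinite_left_of_comp_eq`). [cite: GortzWedhorn2020, Cor. 12.89] [cite: DeJong1996, Lemma 4.13 (proof), p. 70] -/
theorem isFinite_left_of_fibre_charts (hf : IsCompactAbelianPencil f d) (ν : 𝒳 ⟶ 𝒳) (hν : ν ≫ f = f) {N : ℕ} (hN : N ≠ 0)
    (hθ : ∀ s : ComplexPoints S, ∃ (νs : fiberOver f s ⟶ fiberOver f s) (A : AbelianVariety ℂ) (e : A.X ≅ fiberOver f s),
      νs ≫ fiberι f s = fiberι f s ≫ ν ∧ e.hom ≫ νs = (N • 𝟙 A).hom.hom.hom ≫ e.hom) :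
    IsFinite ν.left := by
  haveI := surjective_left_of_fibre_charts hf ν hN hθ
  exact isFinite_left_of_comp_eq hf ν hν

/-- … and locally quasi-finite — the clause carried by the bracket (θ∀) of parts XXIV–XXVIII, now DERIVED. [cite: GortzWedhorn2020, Cor. 12.89] -/
theorem locallyQuasiFinite_left_of_fibre_charts (hf : IsCompactAbelianPencil f d) (ν : 𝒳 ⟶ 𝒳) (hν : ν ≫ f = f) {N : ℕ}
    (hN : N ≠ 0)
    (hθ : ∀ s : ComplexPoints S, ∃ (νs : fiberOver f s ⟶ fiberOver f s) (A : AbelianVariety ℂ) (e : A.X ≅ fiberOver f s),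
      νs ≫ fiberι f s = fiberι f s ≫ ν ∧ e.hom ≫ νs = (N • 𝟙 A).hom.hom.hom ≫ e.hom) :
    LocallyQuasiFinite ν.left := by
  haveI := isFinite_left_of_fibre_charts hf ν hν hN hθ
  infer_instance

end Surjective

/-! ## §2 Node level (display-only brackets): `PencilTheta₀[] ⟹ PencilTheta[]` and the rows re-keyed -/

section Nodes

/-- DISPLAY-ONLY bracket (no `def`; REFEREE-AB F-ab-103): `CMWeights[]` of part XXIV-c, restated verbatim. -/
local notation3 (prettyPrint := false) "CMWeights[]" =>
  ∀ ⦃d : ℕ⦄ ⦃𝒳 S : SchemeOver ℂ⦄ (f : 𝒳 ⟶ S), IsCompactAbelianPencil f d → ∀ t ∈ cmLocus f d,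
    ∃ (ν : 𝒳 ⟶ 𝒳) (_ : LocallyQuasiFinite ν.left) (N : ℕ), 2 ≤ N ∧
      (∀ (k : ℕ) (w : complexBetti 𝒳 k), complexBetti.map (fiberι f t) k (complexBetti.map ν k w) =
        ((N : ℂ) ^ k) • complexBetti.map (fiberι f t) k w) ∧
      (∀ (k k₁ k₂ : ℕ), k₁ + 1 = k → k₂ + 1 = k₁ → ∀ w : complexBetti 𝒳 k, ∃ w₀ w₁ w₂ : complexBetti 𝒳 k,
        w = w₀ + w₁ + w₂ ∧ complexBetti.map ν k w₀ = ((N : ℂ) ^ k) • w₀ ∧ complexBetti.map ν k w₁ = ((N : ℂ) ^ k₁) • w₁ ∧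
        complexBetti.map ν k w₂ = ((N : ℂ) ^ k₂) • w₂) ∧
      (∀ (k : ℕ) (G : complexBetti 𝒳 k), complexBetti.map ν k G = ((N : ℂ) ^ k) • G →
        complexBetti.map (fiberι f t) k G = 0 → G = 0)

/-- DISPLAY-ONLY bracket (no `def`; REFEREE-AB F-ab-103): `CMTopWeightHodge[]` of part XXIV-d, restated verbatim. OPEN; a HYPOTHESIS. -/
local notation3 (prettyPrint := false) "CMTopWeightHodge[]" =>
  ∀ ⦃d : ℕ⦄ ⦃𝒳 S : SchemeOver ℂ⦄ (f : 𝒳 ⟶ S), IsCompactAbelianPencil f d → ∀ t ∈ cmLocus f d,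
    ∀ (ν : 𝒳 ⟶ 𝒳) (_ : LocallyQuasiFinite ν.left) (N : ℕ), 2 ≤ N →
      (∀ (k : ℕ) (w : complexBetti 𝒳 k), complexBetti.map (fiberι f t) k (complexBetti.map ν k w) =
        ((N : ℂ) ^ k) • complexBetti.map (fiberι f t) k w) →
      (∀ (k k₁ k₂ : ℕ), k₁ + 1 = k → k₂ + 1 = k₁ → ∀ w : complexBetti 𝒳 k, ∃ w₀ w₁ w₂ : complexBetti 𝒳 k,
        w = w₀ + w₁ + w₂ ∧ complexBetti.map ν k w₀ = ((N : ℂ) ^ k) • w₀ ∧ complexBetti.map ν k w₁ = ((N : ℂ) ^ k₁) • w₁ ∧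
        complexBetti.map ν k w₂ = ((N : ℂ) ^ k₂) • w₂) →
      (∀ (k : ℕ) (G : complexBetti 𝒳 k), complexBetti.map ν k G = ((N : ℂ) ^ k) • G →
        complexBetti.map (fiberι f t) k G = 0 → G = 0) →
      ∀ (p : ℕ) (y₀ : complexBetti 𝒳 (2 * (p + 1))),
        complexBetti.map ν (2 * (p + 1)) y₀ = ((N : ℂ) ^ (2 * (p + 1))) • y₀ → IsRationalClass y₀ →
        IsOfHodgeType (d + 1) 𝒳 (2 * (p + 1)) (p + 1) (p + 1) y₀ → y₀ ∈ algebraicClasses 𝒳 (p + 1)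

/-- DISPLAY-ONLY bracket (no `def`; REFEREE-AB F-ab-103): (θ∀) `PencilTheta[]` of part XXVI-b, restated verbatim (WITH its clause
`LocallyQuasiFinite ν.left`). -/
local notation3 (prettyPrint := false) "PencilTheta[]" =>
  ∀ ⦃d : ℕ⦄ ⦃𝒳 S : SchemeOver ℂ⦄ (f : 𝒳 ⟶ S), IsCompactAbelianPencil f d → (cmLocus f d).Nonempty →
    ∃ (ν : 𝒳 ⟶ 𝒳) (_ : LocallyQuasiFinite ν.left) (N : ℕ), 2 ≤ N ∧ ν ≫ f = f ∧
      ∀ s : ComplexPoints S, ∃ (νs : fiberOver f s ⟶ fiberOver f s) (A : AbelianVariety ℂ) (e : A.X ≅ fiberOver f s),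
        νs ≫ fiberι f s = fiberι f s ≫ ν ∧ e.hom ≫ νs = (N • 𝟙 A).hom.hom.hom ≫ e.hom

/-- DISPLAY-ONLY bracket (no `def`, not a census node — REFEREE-AB F-ab-103): **`PencilTheta₀[]`** — (θ∀) WITHOUT the local
quasi-finiteness clause: every CM-pointed compact pencil of abelian `d`-folds `f : 𝒳 ⟶ S` carries an `S`-ENDOMORPHISM `ν` (`ν ≫ f = f`)
and an integer `N ≥ 2` such that on EVERY fibre `X_s` the restriction of `ν` is `N · 𝟙_A` in an abelian-variety chart `A.X ≅ X_s`
(print: the multiplication `θ_N` of the abelian scheme `𝒳 / S` — Mumford GIT Thm. 6.14 with rigidity; a PRINT THEOREM, displayed, not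
in the tree: the carriers record a section and fibrewise charts, no group law over `S`). -/
local notation3 (prettyPrint := false) "PencilTheta₀[]" =>
  ∀ ⦃d : ℕ⦄ ⦃𝒳 S : SchemeOver ℂ⦄ (f : 𝒳 ⟶ S), IsCompactAbelianPencil f d → (cmLocus f d).Nonempty →
    ∃ (ν : 𝒳 ⟶ 𝒳) (N : ℕ), 2 ≤ N ∧ ν ≫ f = f ∧
      ∀ s : ComplexPoints S, ∃ (νs : fiberOver f s ⟶ fiberOver f s) (A : AbelianVariety ℂ) (e : A.X ≅ fiberOver f s),
        νs ≫ fiberι f s = fiberι f s ≫ ν ∧ e.hom ≫ νs = (N • 𝟙 A).hom.hom.hom ≫ e.hom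

/-- **`PencilTheta₀[] ⟹ PencilTheta[]`**: the local quasi-finiteness clause of (θ∀) follows from the chart clauses (§1). FACT-FREE.
[cite: MumfordGIT, Thm. 6.14] [cite: GortzWedhorn2020, Cor. 12.89] -/
theorem pencilTheta_of_pencilTheta₀ (hΘ : PencilTheta₀[]) : PencilTheta[] := by
  intro d 𝒳 S f hf hcm
  obtain ⟨ν, N, hN, hνf, hθ⟩ := hΘ f hf hcm
  exact ⟨ν, locallyQuasiFinite_left_of_fibre_charts hf ν hνf (by omega) hθ, N, hN, hνf, hθ⟩

/-- **`PencilTheta₀[] ⟹ CMWeights[]`**: the whole Leray weight package of part XXIV is a kernel consequence of the chart form of the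
abelian-scheme structure (part XXVI-b `cmWeights_of_pencilTheta` after §1). [cite: Milne2020HodgeClassesAV, proof of Prop. 1 (p. 7)]
[cite: MumfordGIT, Thm. 6.14] -/
theorem cmWeights_of_pencilTheta₀ (hΘ : PencilTheta₀[]) : CMWeights[] :=
  cmWeights_of_pencilTheta (pencilTheta_of_pencilTheta₀ hΘ)

/-- **`HC_CM ∧ [CM top-weight Hodge classes algebraic] ⟹ HC_AV`, granted [h₂₁] and (θ∀) in the chart form `PencilTheta₀[]`**
(`HC_CM` = `RankFourFaces.CMAbelianHodge` a HYPOTHESIS, load-bearing). research route, not a corollary; conditional on HC_CM plus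
one named minimal statement. [cite: Andre1996Motifs, Lemme 6.3.1 (p. 31) and Remarque 2 (p. 33)]
[cite: Milne2020HodgeClassesAV, proof of Prop. 1 (pp. 7–8)] [cite: MumfordGIT, Thm. 6.14] -/
theorem HC_AV_of_HC_CM_of_cmTopWeightHodge_of_theta₀ (h₂₁ : andre1996_cmAnchoredPencil) (hΘ : PencilTheta₀[])
    (hCM : RankFourFaces.CMAbelianHodge) (h : CMTopWeightHodge[]) : PadicSemiregularLift.HodgeAbelianVarieties :=
  HC_AV_of_HC_CM_of_cmTopWeightHodge_of_theta h₂₁ (pencilTheta_of_pencilTheta₀ hΘ) hCM h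

/-- **EXACTNESS: `HC_AV ⟺ HC_CM ∧ [CM top-weight Hodge classes algebraic]`, granted [h₂₁], Verdier and (θ∀) in the chart form
`PencilTheta₀[]`.** [cite: Andre1996Motifs, Lemme 6.3.1 (p. 31) and Remarque 2 (p. 33)] [cite: Verdier1976, Cor. 5.1] [cite: MumfordGIT, Thm. 6.14] -/
theorem HC_AV_iff_HC_CM_and_cmTopWeightHodge_of_verdier_of_theta₀ (h₂₁ : andre1996_cmAnchoredPencil)
    (hGT : Verdier1976_genericLocalTriviality) (hΘ : PencilTheta₀[]) :
    PadicSemiregularLift.HodgeAbelianVarieties ↔ (RankFourFaces.CMAbelianHodge ∧ CMTopWeightHodge[]) :=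
  HC_AV_iff_HC_CM_and_cmTopWeightHodge_of_verdier_of_theta h₂₁ hGT (pencilTheta_of_pencilTheta₀ hΘ)

end Nodes

end Summit.HodgeConjecture.HodgeConjecture.Ring2.AbelianAll

end
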